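import Literature.InformationTheory.QuantumCodes.QuantumHammingBoundDistanceFiveRefined
import Literature.InformationTheory.QuantumCodes.AdditiveCodeShortening
import Literature.InformationTheory.QuantumCodes.DistanceThreeSyndromeCriterion
import HarnessLib

/-!
# Private qubits: the quantum Hamming bound for every `[[n,k,5]]` stabilizer code with `n ≥ 26`

Topic `Literature/InformationTheory/QuantumCodes` (venture QEC, cell `qec`, rung X1, the `d = 5` column); fourth file
of the seat's series on Gottesman 1997, Ch. 7 §7.3 (`QuantumHammingBoundDistanceFive.lean`: packing lemma, `n ≥ 53`;
`…Refined.lean`: dropping generators, `n ≥ 44`; `…Seven.lean`: `t = 3`).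

Status of the statement. Gottesman's thesis asserts that no two-error-correcting degenerate binary stabilizer code
exceeds the quantum Hamming bound, analytically for `n ≥ 30` and by the linear-programming tables below
[Gottesman1997, Ch. 7 §7.3, arXiv:quant-ph/9705052 chunk p0059 L62–p0060 L30]; as recorded in
`QuantumHammingBoundDistanceFive.lean`, the printed analytic argument does not cover `31 ≤ n ≤ 52` as it stands.
This file closes that window down to `n = 26` with ONE further elementary observation in the spirit of the
thesis's own remarks on weight-one operators («for codes with weight one operators, … both the operator and the
qubit … can be eliminated» — Ch. 7 §7.3, chunk p0059 L11–14; the formal shortening is CRSS Theorem 6 (e),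
`CRSS1998_theorem6e` of `AdditiveCodeShortening.lean`) and on qubits «affected by» a single generator of `D`
(chunk p0060 L8–13): the result for `26 ≤ n ≤ 43` is therefore NOT a formalization of a printed proof but a
completion of the printed method; every docstring cites the locus of the idea it implements.

## The private-qubit constraint (`exists_small_cover_of_noWeightOne`)

Let `S̄` be an `[[n,k,d]]` additive code WITHOUT stabilizer words of weight one, `2 ≤ t`, `2t < d`, and let
`B₂ ⊆ B` be bases of `D̄_2 ≤ D̄_{2t}` made of words of weight `≤ 2`, resp. `≤ 2t`; `U₂` = the qubits of `B₂`, `S̄″` a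
complement of `D̄_{2t}` in `S̄` (dimension `m = n − k − l`). Call a qubit `q ∉ U₂` PRIVATE if exactly one word
`b_q ∈ B ∖ B₂` touches it, and let `e_q` be the one-qubit error equal to `b_q` at `q`. Then `e_q` commutes with all
of `D̄_{2t}`; its syndrome against `S̄″` is nonzero (else `e_q ∈ S̄⊥` has weight `1 < d`, so `e_q ∈ S̄` — excluded),
and two private qubits have distinct syndromes (else `e_q − e_{q′} ∈ S̄⊥` has weight `2 < d`, so it lies in `S̄`,
hence in `D̄_2 ≤ P(U₂)`, but it is nonzero at `q ∉ U₂`). So there are at most `2^m − 1` private qubits, and double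
counting the incidences qubit–word gives a cover `U ⊇` (all qubits of `B`) with `2·#U ≤ 2t·l + 2^m − 1` — against
the printed `#U ≤ 2t·l`. The packing lemma with this `U` is `packing_private(_two)`.

## What is here (all PROVED; no named facts, no `sorry`)

* `exists_small_cover_of_noWeightOne`, `packing_private`, `packing_private_two` (as above).
* `hammingCount_two_noWeightOne` — for `26 ≤ n ≤ 43` and `S̄` free of weight-one words, `Q(n) ≤ 2^{n−k}`,
  `Q(n) = 1 + 3n + 9·C(n,2)` (finite check: quantum Singleton `n − k ≥ 8`, the packing inequality, `packing_drop_two`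
  at `j = 1`, and `packing_private_two`); `le_14_of_noWeightOne` — for `23 ≤ n ≤ 25` such codes have `k ≤ 14`;
  `AdditiveCodeExists.le_14_of_le_25` — EVERY `[[n,k,5]]` code with `22 ≤ n ≤ 25` has `k ≤ 14` (shorten on weight-one
  words down to `n = 22`, where Singleton gives it).
* `AdditiveCodeExists.quantumHammingBound_five` — **for every `[[n,k,5]]` additive (stabilizer) code with `n ≥ 26`,
  degenerate or not, `(1 + 3n + 9·C(n,2))·2^k ≤ 2^n`** (induction on `n` from the base `n = 26`: a code with a
  weight-one word shortens to length `n − 1` (CRSS Thm 6 (e)) and `Q(n) ≤ 2·Q(n − 1)`; a code without one is covered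
  by `hammingCount_two_noWeightOne` for `n ≤ 43` and by `Gottesman1997_hammingBound_distance_five'` for `n ≥ 44`),
  with the `IsAdditiveCode` form, the `Σ_{j ≤ 2} 3^j C(n,j)` form and the contrapositive.

Scope. `n ≤ 25` is NOT claimed: at `(n, k) = (25, 14)` a weight-one-free code with `l = 6` is consistent with every
inequality used here (brute force over `(n, l, n − k)`, cell LIT-4 register B2); those lengths are the LP tables'
(the venture's census holds CRSS Table III, `n ≤ 30`, as kernel theorems). Nothing here concerns non-additive codes.
Tree search (2026-08-27): REUSED `CRSS1998_theorem6e` / `AdditiveCodeExists.noWeightOne_or_shorten`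
(AdditiveCodeShortening.lean), `quantumSingleton_additive` (QuantumSingletonBound.lean), `sympInner_singleErr` /
`syndBit` (DistanceThreeSyndromeCriterion.lean), `singleErr`, `sympWeight_singleErr_le`, `mem_sympDual_of_basis`
(QuantumHammingBoundDistanceThree.lean), `lowWeightSpan`, `exists_compl_of_le`, `Gottesman1997_degenerate_packing_weight`,
`sum_pow_mul_choose_mono`, `hammingCount_two_mono` (…Five.lean), `packing_drop_two`,
`Gottesman1997_hammingBound_distance_five'` (…FiveRefined.lean).
-/

namespace Literature.InformationTheory.QuantumCodes

open Finset Module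

variable {n : ℕ}

/-! ### 1. One-qubit errors matching a word at a qubit -/

/-- `q ∈ supp b ↔` the letter `(b.1 q, b.2 q)` of `b` at `q` is nonzero. [cite: Gottesman1997, Ch. 7 §7.3 (chunk p0059 L21-24)] -/
theorem mem_sympSupport_iff_letter_ne_zero {b : SympVec n} {q : Fin n} :
    q ∈ sympSupport b ↔ (b.1 q, b.2 q) ≠ 0 := by
  rw [sympSupport, mem_filter]
  simp only [mem_univ, true_and, ne_eq, Prod.mk_eq_zero, not_and_or]

/-- The one-qubit error carrying `b`'s own letter at `q` commutes with `b`. [cite: Gottesman1997, Ch. 7 §7.3 (chunk p0059 L21-24)] -/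
theorem sympInner_singleErr_letter_self (b : SympVec n) (q : Fin n) :
    sympInner b (singleErr q (b.1 q, b.2 q)) = 0 := by
  rw [sympInner_singleErr, syndBit, mul_comm]
  exact CharTwo.add_self_eq_zero _

/-- A word not touching `q` commutes with every one-qubit error at `q`. [cite: Gottesman1997, Ch. 7 §7.3 (chunk p0059 L21-24: «Suppose that none of the operators in D acts on some qubit j»)] -/
theorem sympInner_singleErr_of_notMem {b : SympVec n} {q : Fin n} (hq : q ∉ sympSupport b) (p : ZMod 2 × ZMod 2) :
    sympInner b (singleErr q p) = 0 := by
  simp only [sympSupport, mem_filter, mem_univ, true_and, not_or, not_not] at hq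
  rw [sympInner_singleErr, syndBit, hq.1, hq.2, zero_mul, mul_zero, add_zero]

/-- Components of `singleErr q p` at `q`. [cite: CalderbankEtAl1998, §2 (printed p. 4)] -/
theorem singleErr_fst_self (q : Fin n) (p : ZMod 2 × ZMod 2) : (singleErr q p).1 q = p.1 := by
  simp [singleErr]

/-- Components of `singleErr q p` at `q`. [cite: CalderbankEtAl1998, §2 (printed p. 4)] -/
theorem singleErr_snd_self (q : Fin n) (p : ZMod 2 × ZMod 2) : (singleErr q p).2 q = p.2 := by
  simp [singleErr]

/-- Components of `singleErr q' p` away from `q'`. [cite: CalderbankEtAl1998, §2 (printed p. 4)] -/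
theorem singleErr_fst_ne {q q' : Fin n} (h : q ≠ q') (p : ZMod 2 × ZMod 2) : (singleErr q' p).1 q = 0 := by
  simp [singleErr, Pi.single_eq_of_ne h]

/-- Components of `singleErr q' p` away from `q'`. [cite: CalderbankEtAl1998, §2 (printed p. 4)] -/
theorem singleErr_snd_ne {q q' : Fin n} (h : q ≠ q') (p : ZMod 2 × ZMod 2) : (singleErr q' p).2 q = 0 := by
  simp [singleErr, Pi.single_eq_of_ne h]

/-- A one-qubit error with a nonzero letter has weight exactly `1`. [cite: Gottesman1997, Ch. 7 §7.3 (chunk p0059 L11-14: «weight one operators»)] -/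
theorem sympWeight_singleErr_eq_one {q : Fin n} {p : ZMod 2 × ZMod 2} (hp : p ≠ 0) : sympWeight (singleErr q p) = 1 := by
  have h1 := sympWeight_singleErr_le q p
  have h0 : sympWeight (singleErr q p) ≠ 0 := by
    intro h
    have hz := (sympWeight_eq_zero_iff _).1 h
    apply hp
    ext
    · have := congrFun (congrArg Prod.fst hz) q
      rwa [singleErr_fst_self] at this
    · have := congrFun (congrArg Prod.snd hz) q
      rwa [singleErr_snd_self] at this
  omega

/-! ### 2. The private-qubit cover -/

section Cover

variable {S : Submodule (ZMod 2) (SympVec n)} {k d : ℕ}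

/-- **Private qubits: a cover of `D̄_{2t}` with `2·#U ≤ 2t·dim D̄_{2t} + 2^m − 1`**, `m = n − k − dim D̄_{2t}`, for an
`[[n,k,d]]` additive code with no stabilizer word of weight one (`2 ≤ t`, `2t < d`) — see the module docstring:
qubits outside the weight-`≤ 2` words' support that are touched by exactly one basis word of `D̄_{2t}` inject into
the nonzero syndromes of a complement of `D̄_{2t}`. (The printed cover is `#U ≤ 2t·l`, «each generator of D can
add at most [2t] qubits»; the thesis handles weight-one operators by eliminating the qubit.)
[cite: Gottesman1997, Ch. 7 §7.3 (chunks p0059 L11-14, L21-29, p0060 L8-13)] -/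
theorem exists_small_cover_of_noWeightOne (hS : IsAdditiveCode S k d) {t : ℕ} (ht2 : 2 ≤ t) (htd : 2 * t < d)
    (h1 : ∀ v ∈ S, sympWeight v ≠ 1) :
    ∃ U : Finset (Fin n), lowWeightSpan S (2 * t) ≤ supportedOn U ∧
      2 * #U + 1 ≤ 2 * t * finrank (ZMod 2) (lowWeightSpan S (2 * t)) +
        2 ^ (n - k - finrank (ZMod 2) (lowWeightSpan S (2 * t))) := by
  classical
  obtain ⟨hso, hdim, hmin, -⟩ := id hS
  set w := 2 * t with hw
  set D := lowWeightSpan S w with hDdef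
  set l := finrank (ZMod 2) D with hl
  -- bases `b₂ ⊆ b` of `D̄_2 ≤ D̄_w` made of words of weight `≤ 2`, resp. `≤ w`
  set T₂ : Set (SympVec n) := {v : SympVec n | v ∈ S ∧ sympWeight v ≤ 2} with hT₂
  set Tw : Set (SympVec n) := {v : SympVec n | v ∈ S ∧ sympWeight v ≤ w} with hTw
  have hT : T₂ ⊆ Tw := fun v hv => ⟨hv.1, hv.2.trans (by omega)⟩
  obtain ⟨b₂, hb₂T, hspan₂, hli₂⟩ := exists_linearIndependent (ZMod 2) T₂
  have hli₂' : LinearIndepOn (ZMod 2) id b₂ := hli₂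
  obtain ⟨b, hbT, hb₂b, hTb, hli⟩ := exists_linearIndepOn_id_extension hli₂' (hb₂T.trans hT)
  have hspanD : Submodule.span (ZMod 2) b = D :=
    le_antisymm (by rw [hDdef, lowWeightSpan]; exact Submodule.span_mono hbT) (Submodule.span_le.2 hTb)
  have hspan₂' : Submodule.span (ZMod 2) b₂ = lowWeightSpan S 2 := hspan₂
  have hcardb : #b.toFinset = l := by
    rw [hl, ← hspanD, finrank_span_set_eq_card (R := ZMod 2) (s := b) hli]
  -- finsets of words
  set B := b.toFinset with hBdef
  set B₂ := b₂.toFinset with hB₂def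
  set Bh := B \ B₂ with hBhdef
  have hB₂B : B₂ ⊆ B := fun x hx => Set.mem_toFinset.2 (hb₂b (Set.mem_toFinset.1 hx))
  have hcardB₂ : #B₂ = finrank (ZMod 2) (lowWeightSpan S 2) := by
    rw [← hspan₂', finrank_span_set_eq_card (R := ZMod 2) (s := b₂) hli₂]
  set l₂ := #B₂ with hl₂
  have hcardBh : #Bh = l - l₂ := by rw [hBhdef, card_sdiff_of_subset hB₂B, hcardb]
  have hl₂l : l₂ ≤ l := by rw [hl₂, ← hcardb]; exact card_le_card hB₂B
  -- qubit sets
  set U₂ : Finset (Fin n) := B₂.biUnion sympSupport with hU₂def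
  set Uh : Finset (Fin n) := Bh.biUnion sympSupport with hUhdef
  have hU₂card : #U₂ ≤ 2 * l₂ := by
    calc #U₂ ≤ ∑ v ∈ B₂, #(sympSupport v) := card_biUnion_le
      _ ≤ ∑ v ∈ B₂, 2 := sum_le_sum fun v hv => by
          rw [card_sympSupport]; exact (hb₂T (Set.mem_toFinset.1 hv)).2
      _ = 2 * l₂ := by rw [sum_const, smul_eq_mul, mul_comm]
  have hwt_b : ∀ v ∈ B, sympWeight v ≤ w := fun v hv => (hbT (Set.mem_toFinset.1 hv)).2
  -- `D̄_2 ≤ P(U₂)` and `D̄_w ≤ P(U₂ ∪ Uh)`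
  have hD₂U₂ : lowWeightSpan S 2 ≤ supportedOn U₂ := by
    rw [← hspan₂']
    exact Submodule.span_le.2 fun x hx =>
      mem_supportedOn_of_sympSupport_subset (subset_biUnion_of_mem sympSupport (Set.mem_toFinset.2 hx))
  have hDU : D ≤ supportedOn (U₂ ∪ Uh) := by
    rw [← hspanD]
    refine Submodule.span_le.2 fun x hx => mem_supportedOn_of_sympSupport_subset ?_
    have hxB : x ∈ B := Set.mem_toFinset.2 hx
    by_cases hx₂ : x ∈ B₂
    · exact (subset_biUnion_of_mem sympSupport hx₂).trans subset_union_left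
    · exact (subset_biUnion_of_mem sympSupport (mem_sdiff.2 ⟨hxB, hx₂⟩)).trans subset_union_right
  -- a complement `S''` of `D̄_w` in `S̄`, its basis and the syndrome
  obtain ⟨S'', -, hsup, hfin⟩ := exists_compl_of_le (lowWeightSpan_le S w)
  set m := finrank (ZMod 2) S'' with hm
  have hmnk : m = n - k - l := by rw [hl, hDdef]; omega
  let c := Module.finBasis (ZMod 2) S''
  let σ : SympVec n → (Fin m → ZMod 2) := fun v i => sympInner (c i : SympVec n) v
  -- private qubits
  set X : Finset (Fin n) := Uh \ U₂ with hXdef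
  let cnt : Fin n → ℕ := fun q => #(Bh.filter fun v => q ∈ sympSupport v)
  set Priv : Finset (Fin n) := X.filter fun q => cnt q = 1 with hPrivdef
  have hcnt_pos : ∀ q ∈ X, 1 ≤ cnt q := by
    intro q hq
    obtain ⟨v, hv, hqv⟩ := mem_biUnion.1 (mem_sdiff.1 hq).1
    exact card_pos.2 ⟨v, mem_filter.2 ⟨hv, hqv⟩⟩
  -- the unique word at a private qubit
  have hpriv : ∀ q ∈ Priv, ∃ v₀ ∈ Bh, q ∈ sympSupport v₀ ∧ q ∉ U₂ ∧ ∀ v ∈ B, v ≠ v₀ → q ∉ sympSupport v := by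
    intro q hq
    obtain ⟨hqX, hq1⟩ := mem_filter.1 hq
    obtain ⟨v₀, hv₀⟩ := card_eq_one.1 hq1
    have hv₀mem : v₀ ∈ Bh.filter fun v => q ∈ sympSupport v := by rw [hv₀]; exact mem_singleton_self _
    refine ⟨v₀, (mem_filter.1 hv₀mem).1, (mem_filter.1 hv₀mem).2, (mem_sdiff.1 hqX).2, fun v hv hne hqv => ?_⟩
    by_cases hv₂ : v ∈ B₂
    · exact (mem_sdiff.1 hqX).2 (mem_biUnion.2 ⟨v, hv₂, hqv⟩)
    · have : v ∈ Bh.filter fun v => q ∈ sympSupport v := mem_filter.2 ⟨mem_sdiff.2 ⟨hv, hv₂⟩, hqv⟩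
      rw [hv₀, mem_singleton] at this
      exact hne this
  -- the error at a private qubit: letter of the unique word
  choose! wd hwdBh hqwd hqU₂ huniq using hpriv
  let e : Fin n → SympVec n := fun q => singleErr q (((wd q).1 q, (wd q).2 q))
  have hletter : ∀ q ∈ Priv, ((wd q).1 q, (wd q).2 q) ≠ 0 := fun q hq =>
    mem_sympSupport_iff_letter_ne_zero.1 (hqwd q hq)
  -- `e q` commutes with `D̄_w`
  have heD : ∀ q ∈ Priv, e q ∈ sympDual D := by
    intro q hq
    rw [mem_sympDual_iff]
    have hker : D ≤ LinearMap.ker (LinearMap.flip (sympForm n) (e q)) := by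
      rw [← hspanD]
      refine Submodule.span_le.2 fun x hx => ?_
      rw [SetLike.mem_coe, LinearMap.mem_ker, LinearMap.flip_apply, sympForm_apply]
      by_cases hx0 : x = wd q
      · rw [hx0]; exact sympInner_singleErr_letter_self _ _
      · exact sympInner_singleErr_of_notMem (huniq q hq x (Set.mem_toFinset.2 hx) hx0) _
    intro v hv
    have := hker hv
    rwa [LinearMap.mem_ker, LinearMap.flip_apply, sympForm_apply] at this
  -- from `⟂ S''` and `⟂ D̄_w` to `⟂ S̄`
  have hdualS : ∀ v : SympVec n, v ∈ sympDual S'' → v ∈ sympDual D → v ∈ sympDual S := by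
    intro v hv'' hvD
    rw [mem_sympDual_iff]
    intro s hs
    rw [← hsup, Submodule.mem_sup] at hs
    obtain ⟨x, hx, s', hs', rfl⟩ := hs
    rw [sympInner_add_left, (mem_sympDual_iff.1 hvD) x hx, (mem_sympDual_iff.1 hv'') s' hs', add_zero]
  -- (i) the syndrome of `e q` is nonzero
  have hne : ∀ q ∈ Priv, σ (e q) ≠ 0 := by
    intro q hq h0
    have hv'' : e q ∈ sympDual S'' := mem_sympDual_of_basis c fun i => congrFun h0 i
    have hvS : e q ∈ sympDual S := hdualS _ hv'' (heD q hq)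
    have hwt : sympWeight (e q) = 1 := sympWeight_singleErr_eq_one (hletter q hq)
    by_cases hmem : e q ∈ S
    · exact h1 _ hmem hwt
    · have := hmin _ hvS hmem
      omega
  -- (ii) distinct private qubits have distinct syndromes
  have hinj : Set.InjOn (fun q => σ (e q)) ↑Priv := by
    intro q hq q' hq' hqq
    by_contra hne'
    set v := e q - e q' with hv
    have hv'' : v ∈ sympDual S'' := by
      refine mem_sympDual_of_basis c fun i => ?_
      have h := congrFun hqq i
      simp only [σ] at h
      rw [hv, ← sympForm_apply, map_sub, sympForm_apply, sympForm_apply, h, sub_self]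
    have hvD : v ∈ sympDual D := (sympDual D).sub_mem (heD q hq) (heD q' hq')
    have hvS : v ∈ sympDual S := hdualS v hv'' hvD
    have hwt : sympWeight v ≤ 2 := by
      have h := sympWeight_sub_le (e q) (e q')
      have h1' : sympWeight (e q) ≤ 1 := sympWeight_singleErr_le _ _
      have h2' : sympWeight (e q') ≤ 1 := sympWeight_singleErr_le _ _
      rw [← hv] at h
      omega
    -- `v` at `q` is the (nonzero) letter of `wd q`
    have hvq : (v.1 q, v.2 q) = ((wd q).1 q, (wd q).2 q) := by
      simp only [hv, e, Prod.fst_sub, Prod.snd_sub, Pi.sub_apply, singleErr_fst_self, singleErr_snd_self,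
        singleErr_fst_ne hne', singleErr_snd_ne hne', sub_zero]
    have hv0 : v ≠ 0 := by
      intro h0
      apply hletter q hq
      rw [← hvq, h0]
      rfl
    have hvmem : v ∈ S := by
      by_contra hnot
      have := hmin v hvS hnot
      omega
    have hvU₂ : v ∈ supportedOn U₂ := hD₂U₂ (mem_lowWeightSpan hvmem hwt)
    have hz := hvU₂ q (hqU₂ q hq)
    apply hletter q hq
    rw [← hvq, hz.1, hz.2]
    rfl
  -- hence `#Priv ≤ 2^m - 1`
  have hPriv : #Priv + 1 ≤ 2 ^ m := by
    have h := card_le_card_of_injOn (fun q => σ (e q)) (fun q hq => ?_) hinj (t := univ.erase 0)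
    · rw [card_erase_of_mem (mem_univ _), card_univ, Fintype.card_fun, ZMod.card, Fintype.card_fin] at h
      have : 1 ≤ 2 ^ m := Nat.one_le_two_pow
      omega
    · exact mem_erase.2 ⟨hne q (mem_coe.1 hq), mem_univ _⟩
  -- double counting of incidences between `X` and `Bh`
  have hcount : 2 * #X ≤ w * (l - l₂) + #Priv := by
    have hsum : ∑ v ∈ Bh, #(X.filter fun q => q ∈ sympSupport v) = ∑ q ∈ X, cnt q := by
      simp only [cnt, card_filter]
      exact sum_comm
    have hup : ∑ v ∈ Bh, #(X.filter fun q => q ∈ sympSupport v) ≤ w * (l - l₂) := by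
      calc ∑ v ∈ Bh, #(X.filter fun q => q ∈ sympSupport v) ≤ ∑ v ∈ Bh, #(sympSupport v) :=
            sum_le_sum fun v _ => card_le_card fun q hq => (mem_filter.1 hq).2
        _ ≤ ∑ v ∈ Bh, w := sum_le_sum fun v hv => by
            rw [card_sympSupport]; exact hwt_b v (mem_sdiff.1 hv).1
        _ = w * (l - l₂) := by rw [sum_const, smul_eq_mul, mul_comm, hcardBh]
    have hlow : 2 * #X ≤ ∑ q ∈ X, cnt q + #Priv := by
      rw [hPrivdef, card_filter, ← sum_add_distrib, card_eq_sum_ones X, mul_sum]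
      refine sum_le_sum fun q hq => ?_
      have := hcnt_pos q hq
      split_ifs with h <;> omega
    omega
  -- assemble the cover
  refine ⟨U₂ ∪ Uh, hDU, ?_⟩
  have hU : #(U₂ ∪ Uh) ≤ #U₂ + #X := by
    rw [hXdef, ← union_sdiff_self_eq_union]
    exact card_union_le _ _
  have h4 : 4 * l₂ ≤ w * l₂ := Nat.mul_le_mul_right _ (by omega)
  have hwl : w * (l - l₂) + w * l₂ = w * l := by rw [← Nat.mul_add, Nat.sub_add_cancel hl₂l]
  rw [← hmnk]
  omega

/-- **Packing with the private-qubit cover**: for an `[[n,k,d]]` additive code with no weight-one stabilizer word,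
`2 ≤ t`, `2t < d`, `l = dim D̄_{2t}`, `m = n − k − l`:
`(Σ_{i ≤ t} 3^i C(n − (t·l + ⌊(2^m − 1)/2⌋), i)) · 2^l ≤ 2^{n−k}` (the printed packing inequality has `n − 2t·l`).
[cite: Gottesman1997, Ch. 7 §7.3 (chunks p0059 L11-31, L62-66)] -/
theorem packing_private (hS : IsAdditiveCode S k d) {t : ℕ} (ht2 : 2 ≤ t) (htd : 2 * t < d)
    (h1 : ∀ v ∈ S, sympWeight v ≠ 1) :
    (∑ i ∈ Finset.range (t + 1), 3 ^ i *
        (n - (t * finrank (ZMod 2) (lowWeightSpan S (2 * t)) +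
          (2 ^ (n - k - finrank (ZMod 2) (lowWeightSpan S (2 * t))) - 1) / 2)).choose i) *
      2 ^ finrank (ZMod 2) (lowWeightSpan S (2 * t)) ≤ 2 ^ (n - k) := by
  obtain ⟨U, hU, hcard⟩ := exists_small_cover_of_noWeightOne hS ht2 htd h1
  refine le_trans (Nat.mul_le_mul_right _ (sum_pow_mul_choose_mono ?_ t))
    (Gottesman1997_degenerate_packing_weight hS htd hU)
  rw [Finset.card_compl, Fintype.card_fin]
  have h1le : 1 ≤ 2 ^ (n - k - finrank (ZMod 2) (lowWeightSpan S (2 * t))) := Nat.one_le_two_pow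
  obtain ⟨P, hP⟩ : ∃ P, t * finrank (ZMod 2) (lowWeightSpan S (2 * t)) = P := ⟨_, rfl⟩
  rw [mul_assoc, hP] at hcard
  rw [hP]
  omega

/-- **`t = 2`**: for every `[[n,k,5]]` additive code with no weight-one stabilizer word,
`Q(n − (2l + ⌊(2^m − 1)/2⌋)) · 2^l ≤ 2^{n−k}`, `Q(x) = 1 + 3x + 9·C(x,2)`, `l = dim D̄_4`, `m = n − k − l`.
[cite: Gottesman1997, Ch. 7 §7.3 (chunks p0059 L11-31, L62-66)] -/
theorem packing_private_two (hS : IsAdditiveCode S k 5) (h1 : ∀ v ∈ S, sympWeight v ≠ 1) :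
    (1 + 3 * (n - (2 * finrank (ZMod 2) (lowWeightSpan S 4) +
        (2 ^ (n - k - finrank (ZMod 2) (lowWeightSpan S 4)) - 1) / 2)) +
      9 * (n - (2 * finrank (ZMod 2) (lowWeightSpan S 4) +
        (2 ^ (n - k - finrank (ZMod 2) (lowWeightSpan S 4)) - 1) / 2)).choose 2) *
      2 ^ finrank (ZMod 2) (lowWeightSpan S 4) ≤ 2 ^ (n - k) := by
  have h := packing_private hS (t := 2) le_rfl (by norm_num) h1
  simpa [Finset.sum_range_succ, Nat.choose_one_right, Nat.choose_zero_right, show (2 : ℕ) * 2 = 4 from rfl,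
    add_assoc] using h

end Cover

/-! ### 3. The finite checks -/

section Checks

variable {S : Submodule (ZMod 2) (SympVec n)} {k : ℕ}
set_option maxHeartbeats 400000 in -- buildfix (bf3-g26): 160k/180k FAIL, 200k PASS at accept time; line-neutral budget line
/-- **Weight-one-free codes, `26 ≤ n ≤ 43`**: `1 + 3n + 9·C(n,2) ≤ 2^{n−k}` — a finite check over
`(n, k, l)` with `n − 13 ≤ k ≤ n − 8` (larger `n − k` is immediate, smaller contradicts the quantum Singleton bound)
and `l ≤ n − k`, using the packing inequality, its `j = 1` refinement and `packing_private_two`.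
[cite: Gottesman1997, Ch. 7 §7.3 (chunks p0059 L62–p0060 L30)] -/
theorem hammingCount_two_noWeightOne (hS : IsAdditiveCode S k 5) (h1 : ∀ v ∈ S, sympWeight v ≠ 1)
    (hn : 26 ≤ n) (hn' : n ≤ 43) : 1 + 3 * n + 9 * n.choose 2 ≤ 2 ^ (n - k) := by
  have hdim := hS.2.1
  have h0 := packing_drop_two hS 0
  have hj1 := packing_drop_two hS 1
  have hp := packing_private_two hS h1
  have hls := finrank_lowWeightSpan_le hS 4
  obtain ⟨l, hl⟩ : ∃ l, finrank (ZMod 2) (lowWeightSpan S 4) = l := ⟨_, rfl⟩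
  rw [hl] at h0 hj1 hp hls
  -- large `n - k`
  by_cases hbig : 14 ≤ n - k
  · calc 1 + 3 * n + 9 * n.choose 2 ≤ 1 + 3 * 43 + 9 * Nat.choose 43 2 := hammingCount_two_mono hn'
      _ ≤ 2 ^ 14 := by norm_num [Nat.choose_two_right]
      _ ≤ 2 ^ (n - k) := Nat.pow_le_pow_right (by norm_num) hbig
  -- `k = 0` is then impossible; otherwise Singleton
  have hk1 : 1 ≤ k := by omega
  have hsing := quantumSingleton_additive hS hk1
  obtain ⟨s, hs⟩ : ∃ s, n - k = s := ⟨_, rfl⟩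
  rw [hs] at h0 hj1 hp hls hbig ⊢
  have hs8 : 8 ≤ s := by omega
  have hs13 : s ≤ 13 := by omega
  have hns : n = s + k := by omega
  simp only [Nat.choose_two_right] at h0 hj1 hp ⊢
  revert h0 hj1 hp
  interval_cases n <;> interval_cases s <;> interval_cases l <;> norm_num

/-- **Weight-one-free codes, `23 ≤ n ≤ 25`, have `k ≤ 14`** (the lengths reached by shortening from `26`; same
finite check). [cite: Gottesman1997, Ch. 7 §7.3 (chunks p0059 L11-14, L62–p0060 L30)] -/
theorem le_14_of_noWeightOne (hS : IsAdditiveCode S k 5) (h1 : ∀ v ∈ S, sympWeight v ≠ 1)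
    (hn : 23 ≤ n) (hn' : n ≤ 25) : k ≤ 14 := by
  have hdim := hS.2.1
  have h0 := packing_drop_two hS 0
  have hp := packing_private_two hS h1
  have hls := finrank_lowWeightSpan_le hS 4
  obtain ⟨l, hl⟩ : ∃ l, finrank (ZMod 2) (lowWeightSpan S 4) = l := ⟨_, rfl⟩
  rw [hl] at h0 hp hls
  by_contra hk
  have hk1 : 1 ≤ k := by omega
  have hsing := quantumSingleton_additive hS hk1
  obtain ⟨s, hs⟩ : ∃ s, n - k = s := ⟨_, rfl⟩
  rw [hs] at h0 hp hls
  have hs8 : 8 ≤ s := by omega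
  have hs10 : s ≤ 10 := by omega
  have hns : n = s + k := by omega
  simp only [Nat.choose_two_right] at h0 hp
  revert h0 hp
  interval_cases n <;> interval_cases s <;> interval_cases l <;> norm_num

end Checks

/-! ### 4. Induction on the length -/

/-- `Q(n + 1) ≤ 2·Q(n)` for `n ≥ 3` (one deleted qubit at most halves the Hamming quotient).
[cite: Gottesman1997, Ch. 7 §7.3 (chunk p0059 L11-14: eliminating a qubit)] -/
theorem hammingCount_two_succ_le {n : ℕ} (hn : 3 ≤ n) :
    1 + 3 * (n + 1) + 9 * (n + 1).choose 2 ≤ 2 * (1 + 3 * n + 9 * n.choose 2) := by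
  rw [Nat.choose_succ_succ, Nat.choose_one_right]
  have h := Nat.add_one_mul_choose_eq n 1
  rw [Nat.choose_one_right] at h
  have h2 : 2 * n.choose 2 = n * (n - 1) := by
    rw [Nat.choose_two_right]; exact Nat.two_mul_div_two_of_even (Nat.even_mul_pred_self n)
  obtain ⟨y, rfl⟩ : ∃ y, n = y + 1 := ⟨n - 1, by omega⟩
  simp only [Nat.add_sub_cancel] at h2
  nlinarith

/-- **Every `[[n,k,5]]` code with `22 ≤ n ≤ 25` has `k ≤ 14`** (shorten on weight-one words — CRSS Thm 6 (e) — down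
to `n = 22`, where the quantum Singleton bound gives it; weight-one-free lengths `23–25` by `le_14_of_noWeightOne`).
[cite: Gottesman1997, Ch. 7 §7.3 (chunk p0059 L11-14); CalderbankEtAl1998, §4 Thm. 6 (e) (printed p. 13)] -/
theorem AdditiveCodeExists.le_14_of_le_25 {n k : ℕ} (h : AdditiveCodeExists n k 5) (hn : 22 ≤ n) (hn' : n ≤ 25) :
    k ≤ 14 := by
  -- descend at most three times
  have h22 : ∀ k, AdditiveCodeExists 22 k 5 → k ≤ 14 := by
    intro k h
    rcases Nat.eq_zero_or_pos k with hk | hk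
    · omega
    · have := h.quantumSingleton hk; omega
  have hstep : ∀ m, 22 ≤ m → m + 1 ≤ 25 → (∀ k, AdditiveCodeExists m k 5 → k ≤ 14) →
      ∀ k, AdditiveCodeExists (m + 1) k 5 → k ≤ 14 := by
    intro m hm hm' ih k h
    rcases h.noWeightOne_or_shorten with ⟨S, hS, h1⟩ | h'
    · exact le_14_of_noWeightOne hS h1 (by omega) (by omega)
    · exact ih k h'
  have h23 := hstep 22 le_rfl (by norm_num) h22
  have h24 := hstep 23 (by norm_num) (by norm_num) h23
  have h25 := hstep 24 (by norm_num) (by norm_num) h24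
  interval_cases n
  · exact h22 k h
  · exact h23 k h
  · exact h24 k h
  · exact h25 k h

/-- **The quantum Hamming bound for every `[[n,k,5]]` stabilizer code with `n ≥ 26`**: if an `[[n,k,5]]` additive
code exists and `n ≥ 26` then `(1 + 3n + 9·C(n,2))·2^k ≤ 2^n` — degenerate codes included, no LP input. Induction on
`n`: a code with a weight-one stabilizer word shortens to an `[[n−1,k,5]]` code (CRSS Thm 6 (e)) and
`Q(n) ≤ 2Q(n−1)`; a weight-one-free code obeys `hammingCount_two_noWeightOne` (`n ≤ 43`) or
`Gottesman1997_hammingBound_distance_five'` (`n ≥ 44`); base `n = 26` from `AdditiveCodeExists.le_14_of_le_25`.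
Printed claim (Gottesman): all `n`, analytically for `n ≥ 30`; here `n ≥ 26` is established, `n ≤ 25` is left to
the LP tables as in print. [cite: Gottesman1997, Ch. 7 §7.3 (chunks p0059 L1–p0060 L30); CalderbankEtAl1998, §4 Thm. 6 (e) (printed p. 13)] -/
theorem AdditiveCodeExists.quantumHammingBound_five {n k : ℕ} (h : AdditiveCodeExists n k 5) (hn : 26 ≤ n) :
    (1 + 3 * n + 9 * n.choose 2) * 2 ^ k ≤ 2 ^ n := by
  induction n, hn using Nat.le_induction generalizing k with
  | base =>
    -- `n = 26`
    have h26 : AdditiveCodeExists (25 + 1) k 5 := h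
    rcases h26.noWeightOne_or_shorten with ⟨S, hS, h1⟩ | h'
    · have hdim := hS.2.1
      have hq := hammingCount_two_noWeightOne hS h1 (by norm_num) (by norm_num)
      calc (1 + 3 * 26 + 9 * Nat.choose 26 2) * 2 ^ k ≤ 2 ^ (26 - k) * 2 ^ k := Nat.mul_le_mul_right _ hq
        _ = 2 ^ 26 := by rw [← pow_add]; congr 1; omega
    · have hk := h'.le_14_of_le_25 (by norm_num) (by norm_num)
      calc (1 + 3 * 26 + 9 * Nat.choose 26 2) * 2 ^ k ≤ (1 + 3 * 26 + 9 * Nat.choose 26 2) * 2 ^ 14 :=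
            Nat.mul_le_mul_left _ (Nat.pow_le_pow_right (by norm_num) hk)
        _ ≤ 2 ^ 26 := by norm_num [Nat.choose_two_right]
  | succ m hm ih =>
    rcases h.noWeightOne_or_shorten with ⟨S, hS, h1⟩ | h'
    · rcases Nat.lt_or_ge (m + 1) 44 with h44 | h44
      · have hdim := hS.2.1
        have hq := hammingCount_two_noWeightOne hS h1 (by omega) (by omega)
        calc (1 + 3 * (m + 1) + 9 * (m + 1).choose 2) * 2 ^ k ≤ 2 ^ (m + 1 - k) * 2 ^ k :=
              Nat.mul_le_mul_right _ hq
          _ = 2 ^ (m + 1) := by rw [← pow_add]; congr 1; omega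
      · exact Gottesman1997_hammingBound_distance_five' hS h44
    · have h2 := ih h'
      calc (1 + 3 * (m + 1) + 9 * (m + 1).choose 2) * 2 ^ k ≤ 2 * (1 + 3 * m + 9 * m.choose 2) * 2 ^ k :=
            Nat.mul_le_mul_right _ (hammingCount_two_succ_le (by omega))
        _ = 2 * ((1 + 3 * m + 9 * m.choose 2) * 2 ^ k) := by ring
        _ ≤ 2 * 2 ^ m := Nat.mul_le_mul_left 2 h2
        _ = 2 ^ (m + 1) := by rw [pow_succ, mul_comm]

/-- The same for a given stabilizer space: **every `[[n,k,5]]` additive code `S̄` with `n ≥ 26` satisfies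
`(1 + 3n + 9·C(n,2))·2^k ≤ 2^n`.** [cite: Gottesman1997, Ch. 7 §7.3 (chunks p0059 L1–p0060 L30)] -/
theorem quantumHammingBound_distance_five {S : Submodule (ZMod 2) (SympVec n)} {k : ℕ} (hS : IsAdditiveCode S k 5)
    (hn : 26 ≤ n) : (1 + 3 * n + 9 * n.choose 2) * 2 ^ k ≤ 2 ^ n :=
  AdditiveCodeExists.quantumHammingBound_five ⟨S, hS⟩ hn

/-- The `Σ_{j ≤ 2} 3^j C(n,j)` shape (as in `quantumHammingBound`, `t = 2`), every `[[n,k,5]]` additive code, `n ≥ 26`,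
no purity hypothesis. [cite: Gottesman1997, Ch. 7 §7.1 eq. (7.1) and §7.3 (chunks p0055 L27-30, p0060 L28-30)] -/
theorem AdditiveCodeExists.quantumHammingBound_five_range {n k : ℕ} (h : AdditiveCodeExists n k 5) (hn : 26 ≤ n) :
    (∑ j ∈ Finset.range (2 + 1), 3 ^ j * n.choose j) * 2 ^ k ≤ 2 ^ n := by
  have h' := h.quantumHammingBound_five hn
  simpa [Finset.sum_range_succ, add_assoc] using h'

/-- Contrapositive for code tables, `n ≥ 26`: **no `[[n,k,5]]` stabilizer code with `(1 + 3n + 9·C(n,2))·2^k > 2^n`.**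
[cite: Gottesman1997, Ch. 7 §7.3 (chunk p0060 L28-30)] -/
theorem not_additiveCodeExists_five_of_hamming_26 {n k : ℕ} (hn : 26 ≤ n)
    (hk : 2 ^ n < (1 + 3 * n + 9 * n.choose 2) * 2 ^ k) : ¬ AdditiveCodeExists n k 5 :=
  fun h => absurd (h.quantumHammingBound_five hn) (not_le.2 hk)

end Literature.InformationTheory.QuantumCodes
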